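import Mathlib
import Literature.Geometry.DiscreteGeometry.TwoShellPatterns
import Summits.AtomisticToContinuum.Crystallization.Theorems.PhononSlackCertificatesNearFarGlueRCoverFcc

/-!
# The cuboctahedron directions `2/3`-cover the sphere (line `Sketch`, stub `stub_coverFccSharp`)

Support file for the crux `PhononSlackCertificates.NearFarGlueR` (stmt-AtomisticToContinuum-14970),
line `Sketch`.  The line reduces the crux to a residual contact gap on bad particles adjacent to a
good one; the descent step needs the SHARP covering constant of the first fcc shell: for every unit
vector `w` of `ℝ³` one of the twelve first-shell (unit) vectors `v` of `fccTwoShellPattern` — the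
cuboctahedron vertices `(±1, ±1, 0)/√2` and permutations — satisfies `⟪v, w⟫ ≥ 2/3` (the optimum
is `1/√2 ≈ 0.707`, attained at `w = (1, 0, 0)`).

PROOF (two largest coordinates).  Let `c` be an index of a smallest `|wᵢ|` and `a, b` the other
two.  Choose signs `sₐ, s_b ∈ {±1}` with `sₐ wₐ = |wₐ|`, `s_b w_b = |w_b|`; the integer vector with
`sₐ` at `a`, `s_b` at `b` and `0` at `c` lies in `fccInt`, and the corresponding unit pattern vector
`v` has `⟪v, w⟫ = (|wₐ| + |w_b|)/√2`.  Since `|wₐ| |w_b| ≥ |w_c|²`,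
`(|wₐ| + |w_b|)² ≥ wₐ² + w_b² + w_c² = 1`, so `⟪v, w⟫ ≥ 1/√2 > 2/3` (`√2 < 3/2`).

Leans on the landed helpers `coverFcc_sign`, `coverFcc_candidate`
(`PhononSlackCertificatesNearFarGlueRCoverFcc`), on `fccTwoShellPattern`, `fccInt`
(`Literature/Geometry/DiscreteGeometry/{KissingPatterns,TwoShellPatterns}.lean`) and Mathlib only.
No new definitions, no named facts.
-/

noncomputable section

namespace Summit.AtomisticToContinuum.Crystallization.Theorems.PhononSlackCertificatesNearFarGlueR

open Literature.Geometry.DiscreteGeometry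
open scoped BigOperators RealInnerProductSpace

/-- If an integer vector `(p, q, r)` of `fccInt` has `p w₀ + q w₁ + r w₂ ≥ 1`, then the unit
pattern vector `(p, q, r)/√2` of the fcc two-shell pattern has inner product `≥ 2/3` with `w`
(because `2/3 · √2 < 1`). [folklore] -/
theorem coverFccSharp_of_one_le {p q r : ℤ} (hu : (![p, q, r] : Fin 3 → ℤ) ∈ fccInt)
    (w : EuclideanSpace ℝ (Fin 3))
    (h : 1 ≤ (p : ℝ) * w 0 + (q : ℝ) * w 1 + (r : ℝ) * w 2) :
    ∃ v ∈ fccTwoShellPattern, ‖v‖ = 1 ∧ (2 / 3 : ℝ) ≤ ⟪v, w⟫ := by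
  obtain ⟨v, hv, hn, hi⟩ := coverFcc_candidate hu w
  refine ⟨v, hv, hn, ?_⟩
  have hs2pos : 0 < Real.sqrt 2 := by positivity
  have hs2 : Real.sqrt 2 < 3 / 2 := by
    rw [Real.sqrt_lt' (by norm_num)]
    norm_num
  rw [hi, le_div_iff₀ hs2pos]
  linarith

/-- **The cuboctahedron directions `2/3`-cover the sphere**: for every unit vector `w` some unit
vector `v` of the fcc two-shell pattern has `⟪v, w⟫ ≥ 2/3`. [folklore] -/
theorem stub_coverFccSharp :
    ∀ w : EuclideanSpace ℝ (Fin 3), ‖w‖ = 1 →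
      ∃ v ∈ fccTwoShellPattern, ‖v‖ = 1 ∧ (2 / 3 : ℝ) ≤ ⟪v, w⟫ := by
  intro w hw
  -- signs of the coordinates
  obtain ⟨a, ha, ha'⟩ := coverFcc_sign (w 0)
  obtain ⟨b, hb, hb'⟩ := coverFcc_sign (w 1)
  obtain ⟨c, hc, hc'⟩ := coverFcc_sign (w 2)
  -- the three signed pattern vectors
  have h01 : (![a, b, 0] : Fin 3 → ℤ) ∈ fccInt := by
    rcases ha with rfl | rfl <;> rcases hb with rfl | rfl <;> decide
  have h02 : (![a, 0, c] : Fin 3 → ℤ) ∈ fccInt := by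
    rcases ha with rfl | rfl <;> rcases hc with rfl | rfl <;> decide
  have h12 : (![0, b, c] : Fin 3 → ℤ) ∈ fccInt := by
    rcases hb with rfl | rfl <;> rcases hc with rfl | rfl <;> decide
  -- `|w₀|² + |w₁|² + |w₂|² = 1` from `‖w‖ = 1`
  have hnorm : w 0 ^ 2 + w 1 ^ 2 + w 2 ^ 2 = 1 := by
    have h := EuclideanSpace.real_norm_sq_eq w
    rw [hw, Fin.sum_univ_three] at h
    linarith
  have hsq : |w 0| ^ 2 + |w 1| ^ 2 + |w 2| ^ 2 = 1 := by
    simp only [sq_abs]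
    exact hnorm
  have hx := abs_nonneg (w 0)
  have hy := abs_nonneg (w 1)
  have hz := abs_nonneg (w 2)
  -- case split on a smallest coordinate: the two largest `|wᵢ|` sum to at least `1`
  rcases le_total |w 2| |w 0| with h20 | h02'
  · rcases le_total |w 2| |w 1| with h21 | h12'
    · -- `|w 2|` is smallest: pair `(0, 1)`
      have hp : |w 2| * |w 2| ≤ |w 0| * |w 1| := mul_le_mul h20 h21 hz hx
      refine coverFccSharp_of_one_le h01 w ?_
      simp only [Int.cast_zero, zero_mul, add_zero]
      rw [ha', hb']
      nlinarith
    · -- `|w 1| ≤ |w 2| ≤ |w 0|`: pair `(0, 2)`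
      have hp : |w 1| * |w 1| ≤ |w 0| * |w 2| := mul_le_mul (h12'.trans h20) h12' hy hx
      refine coverFccSharp_of_one_le h02 w ?_
      simp only [Int.cast_zero, zero_mul, add_zero]
      rw [ha', hc']
      nlinarith
  · rcases le_total |w 0| |w 1| with h01' | h10
    · -- `|w 0|` is smallest: pair `(1, 2)`
      have hp : |w 0| * |w 0| ≤ |w 1| * |w 2| := mul_le_mul h01' h02' hx hy
      refine coverFccSharp_of_one_le h12 w ?_
      simp only [Int.cast_zero, zero_mul, zero_add]
      rw [hb', hc']
      nlinarith
    · -- `|w 1| ≤ |w 0| ≤ |w 2|`: pair `(0, 2)`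
      have hp : |w 1| * |w 1| ≤ |w 0| * |w 2| := mul_le_mul h10 (h10.trans h02') hy hx
      refine coverFccSharp_of_one_le h02 w ?_
      simp only [Int.cast_zero, zero_mul, add_zero]
      rw [ha', hc']
      nlinarith

end Summit.AtomisticToContinuum.Crystallization.Theorems.PhononSlackCertificatesNearFarGlueR

end
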